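import Mathlib
import Summits.KontsevichZagierPeriods.Zeta5Search.Ray4FrameL5
import Summits.KontsevichZagierPeriods.Zeta5Search.LawA4Proof
import Summits.KontsevichZagierPeriods.Zeta5Search.ShapeClauseTransfer
import HarnessLib

/-!
# THEOREM A⁗ (`LawA4`) by name on ray #4 — the two `LawA4` windows near `θ = 1` (gen-2 g16)

HONEST FRAMING: systematic search; no irrationality claim unless certified.

Ray #4 of the census T1 map: `b = n·(34; 14,13,12,11,10,9,8) = CellKit.bLin (8n) (6n) n` (`d = 25n`).
`SecondOrder.LawA4` (THEOREM A⁗, `casLB + 4 = 7 − 2M` under the frame clauses `LawA4Classes b p M T`) is the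
tree theorem `SecondOrder.lawA4_holds` (LawA4Proof.lean), so everything here is UNCONDITIONAL except the two
`@[conjecture]` class-structure nodes (∀ n), which are decidable per instance.

* §1 `lawA4_bLin` / `lawA4_ray4`: THEOREM A⁗ on any linear ray `bLin a e n` (`a ≤ 15n + 3e`) resp. on ray #4.
* §2 the census's two largest ray-#4 'U' regions are covered by the FIXED frames of `Ray4FrameL5.lean`:
  `(56, T56R4)` on `θ = p/n ∈ (17/18, 1]` and `(52, T52R4)` on `θ ∈ (1, 18/17]` — conjecture nodes
  `Ray4ClassesA4M56` / `Ray4ClassesA4M52` (fixed-frame check of `LawA4Classes` at EVERY window prime with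
  `2 ≤ n ≤ 130`: 98/98 resp. 85/85, 0 exceptions — `pub-zeta5-gen-2/g16/r4a4shapes_2_130.json`) and the PROVED reductions `ray4WindowA4M56_of` (`v_p(Cas₇) ≥ −105`) and
  `ray4WindowA4M52_of` (`≥ −97`).  (On the sub-windows `(17/18, 25/26]` and `(1, 25/24]` THEOREM L5 gives one
  more — `Ray4FrameL5.lean`; the parts `(25/26, 1]` and `(25/24, 18/17]` are `LawA4`-exact in the census atlas.)
* §4 TRANSFER (typer g13's `ShapeClauseTransfer`, general in `b`): `ray4FrameL5_of_unshifted` — the L5 frame predicate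
  `Ray4FrameL5 n p M T` of `Ray4FrameL5.lean` follows from the UNSHIFTED clauses alone; hence the L5 nodes
  `Ray4ShapesL5M52/M56` follow from the `LawA4` nodes of §2 plus the shape-clause-only statements `Ray4ShapeM52/M56`
  (`ray4ShapesL5M52_of_classes`, `ray4ShapesL5M56_of_classes`) — the division of labour for the ∀-n machines
  (A4 machine: §2 nodes; long-class machine: one shape clause per class).
* §3 kernel instances at `LawA4`-only points: `(38,37)`, `(75,73)` (`θ ∈ (25/26, 1]`, frame 56) and `(35,37)`,
  `(70,73)` (`θ ∈ (25/24, 18/17]`, frame 52) by `decide` through `ClassDataDecide.lawA4Classes_of_cert` ⇒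
  UNCONDITIONAL `ray4_casoratianA4_<n>_<p>`: `v_p(Cas₇(b)) ≥ −105` resp. `−97`.
-/

namespace Summit.KontsevichZagierPeriods.Zeta5Search.Ray4Windows

open Summit.KontsevichZagierPeriods.Zeta5Search.ClusterValuation
open Summit.KontsevichZagierPeriods.Zeta5Search.CasoratianValuation (InPolytope shift casoratian)
open Summit.KontsevichZagierPeriods.Zeta5Search.SecondOrder (isRaise2 raiseAtList LawA4 lawA4_holds lawA4Classes_shift shapeClause_shift)
open Summit.KontsevichZagierPeriods.Zeta5Search.SecondResidueLaw (ShapeClause)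
open Summit.KontsevichZagierPeriods.Zeta5Search.RecordWindowsA4 (LawA4Classes lawA4_apply)
open Summit.KontsevichZagierPeriods.Zeta5Search.ClassDecide
open Summit.KontsevichZagierPeriods.Zeta5Search.CellKit (bLin bLin_zero bLin_succ inPolytope_bLin inPolytope_shift_bLin)

/-! ## §1 THEOREM A⁗ on a linear ray -/

/-- **THEOREM A⁗ on a linear ray `bLin a e n`** (`a ≤ 15n + 3e`, direction `e₇`): the frame clauses
`LawA4Classes b p M T` give `v_p(Cas₇(b)) ≥ 7 − 2M` — unconditionally (`LawA4` = `SecondOrder.lawA4_holds`). -/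
theorem lawA4_bLin (a e n p M : ℕ) (T : List ℤ) (hn : 1 ≤ n) (ha : a + 1 ≤ 15 * n + 3 * e) (hp : p.Prime) (h5 : 5 ≤ p)
    (hpn : p ≤ 2 * a + 12 * n + e) (hsq : 2 * a + 12 * n + e + 2 < p ^ 2) (hM : 6 ≤ M) (hE : Even M) (hT : T.reverse = T)
    (hC : LawA4Classes (bLin a e n) p M T) (hne : casoratian (bLin a e n) 7 ≠ 0) :
    (7 : ℤ) - 2 * M ≤ padicValRat p (casoratian (bLin a e n) 7) := by
  have hpb : (p : ℤ) ≤ bLin a e n 0 := by rw [bLin_zero]; exact_mod_cast hpn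
  have hp2 : (bLin a e n 0 + 2 : ℤ) < (p : ℤ) ^ 2 := by rw [bLin_zero]; exact_mod_cast hsq
  exact lawA4_apply lawA4_holds (bLin a e n) p 7 M T (inPolytope_bLin (by omega)) (inPolytope_shift_bLin hn ha)
    (by norm_num) (by norm_num) hp h5 hpb hp2 hM hE hT hC hne

/-- **THEOREM A⁗ on ray #4** `b = bLin (8n) (6n) n = n·(34;14,…,8)` (`b₀ = 34n`). -/
theorem lawA4_ray4 (n p M : ℕ) (T : List ℤ) (hn : 1 ≤ n) (hp : p.Prime) (h5 : 5 ≤ p) (hpn : p ≤ 34 * n)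
    (hsq : 34 * n + 2 < p ^ 2) (hM : 6 ≤ M) (hE : Even M) (hT : T.reverse = T)
    (hC : LawA4Classes (bLin (8 * n) (6 * n) n) p M T) (hne : casoratian (bLin (8 * n) (6 * n) n) 7 ≠ 0) :
    (7 : ℤ) - 2 * M ≤ padicValRat p (casoratian (bLin (8 * n) (6 * n) n) 7) :=
  lawA4_bLin (8 * n) (6 * n) n p M T hn (by omega) hp h5 (by omega) (by omega) hM hE hT hC hne

/-- A window prime with `p² > 34n + 2`, `n ≥ 2` is at least `5`. -/
private theorem five_le_of_sq_ray4 (n p : ℕ) (hn : 2 ≤ n) (h : 34 * n + 2 < p ^ 2) : 5 ≤ p := by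
  by_contra hc
  have hp4 : p ≤ 4 := by omega
  have : p ^ 2 ≤ 4 ^ 2 := Nat.pow_le_pow_left hp4 2
  omega

/-! ## §2 The two `LawA4` windows of ray #4 near `θ = 1` (∀ n: conjecture nodes; reductions PROVED) -/

/-- **CLASS STRUCTURE (frame 56) on `θ ∈ (17/18, 1]`**: `LawA4Classes (bLin (8n) (6n) n) p 56 T56R4` for every
window prime (`17n < 18p`, `p ≤ n`, `p² > 34n + 2`).  Decidable per instance; fixed-frame check at every window
prime with `2 ≤ n ≤ 130`: 98/98 (gen-2 g16 `r4a4shapes.py`). -/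
@[conjecture] def Ray4ClassesA4M56 : Prop :=
  ∀ n p : ℕ, 2 ≤ n → p.Prime → 17 * n < 18 * p → p ≤ n → 34 * n + 2 < p ^ 2 →
    LawA4Classes (bLin (8 * n) (6 * n) n) p 56 T56R4

/-- **CLASS STRUCTURE (frame 52) on `θ ∈ (1, 18/17]`**: `LawA4Classes (bLin (8n) (6n) n) p 52 T52R4` for every
window prime (`n < p`, `17p ≤ 18n`, `p² > 34n + 2`).  Fixed-frame check `2 ≤ n ≤ 130`: 85/85 (gen-2 g16). -/
@[conjecture] def Ray4ClassesA4M52 : Prop :=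
  ∀ n p : ℕ, 2 ≤ n → p.Prime → n < p → 17 * p ≤ 18 * n → 34 * n + 2 < p ^ 2 →
    LawA4Classes (bLin (8 * n) (6 * n) n) p 52 T52R4

/-- **RAY-#4 WINDOW (frame 56)**, `θ ∈ (17/18, 1]`: `v_p(Cas₇(b)) ≥ 7 − 112 = −105`. -/
def Ray4WindowA4M56 : Prop :=
  ∀ n p : ℕ, 2 ≤ n → p.Prime → 17 * n < 18 * p → p ≤ n → 34 * n + 2 < p ^ 2 →
    casoratian (bLin (8 * n) (6 * n) n) 7 ≠ 0 → (-105 : ℤ) ≤ padicValRat p (casoratian (bLin (8 * n) (6 * n) n) 7)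

/-- **RAY-#4 WINDOW (frame 52)**, `θ ∈ (1, 18/17]`: `v_p(Cas₇(b)) ≥ 7 − 104 = −97`. -/
def Ray4WindowA4M52 : Prop :=
  ∀ n p : ℕ, 2 ≤ n → p.Prime → n < p → 17 * p ≤ 18 * n → 34 * n + 2 < p ^ 2 →
    casoratian (bLin (8 * n) (6 * n) n) 7 ≠ 0 → (-97 : ℤ) ≤ padicValRat p (casoratian (bLin (8 * n) (6 * n) n) 7)

/-- **Reduction (PROVED)**: the class structure gives the frame-56 window bound, unconditionally in `LawA4`. -/
theorem ray4WindowA4M56_of (hS : Ray4ClassesA4M56) : Ray4WindowA4M56 := by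
  intro n p hn hp h1 h2 h3 hne
  have key := lawA4_ray4 n p 56 T56R4 (by omega) hp (five_le_of_sq_ray4 n p hn h3) (by omega) h3 (by norm_num) (by decide)
    T56R4_reverse (hS n p hn hp h1 h2 h3) hne
  have e : (7 : ℤ) - 2 * ((56 : ℕ) : ℤ) = -105 := by norm_num
  rw [e] at key; exact key

/-- **Reduction (PROVED)**: the class structure gives the frame-52 window bound. -/
theorem ray4WindowA4M52_of (hS : Ray4ClassesA4M52) : Ray4WindowA4M52 := by
  intro n p hn hp h1 h2 h3 hne
  have key := lawA4_ray4 n p 52 T52R4 (by omega) hp (five_le_of_sq_ray4 n p hn h3) (by omega) h3 (by norm_num) (by decide)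
    T52R4_reverse (hS n p hn hp h1 h2 h3) hne
  have e : (7 : ℤ) - 2 * ((52 : ℕ) : ℤ) = -97 := by norm_num
  rw [e] at key; exact key

/-! ## §3 Kernel instances at `LawA4`-only points (the witness lists are the `ν = −M + 2` type lists there) -/

/-- The `ν = −56 + 2` type lists at the frame-56 instances below (double raises of `T56R4`). -/
def W2A4R4M56 : List (List ℤ) :=
  [raiseAtList (raiseAtList T56R4 13) 14,
   raiseAtList (raiseAtList T56R4 20) 21]

/-- Every entry of `W2A4R4M56` is an admissible double raise of `T56R4`. -/
theorem W2A4R4M56_ok : ∀ S ∈ W2A4R4M56, isRaise2 T56R4 S = true := by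
  intro S hS
  simp only [W2A4R4M56, List.mem_cons, List.not_mem_nil, or_false] at hS
  rcases hS with rfl | rfl
  · exact isRaise2_of_raise_raise T56R4 (by decide) (by decide)
  · exact isRaise2_of_raise_raise T56R4 (by decide) (by decide)

/-- The `ν = −52 + 2` type lists at the frame-52 instances below (double raises of `T52R4`). -/
def W2A4R4M52 : List (List ℤ) :=
  [raiseAtList (raiseAtList T52R4 7) 8,
   raiseAtList (raiseAtList T52R4 23) 24]

/-- Every entry of `W2A4R4M52` is an admissible double raise of `T52R4`. -/
theorem W2A4R4M52_ok : ∀ S ∈ W2A4R4M52, isRaise2 T52R4 S = true := by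
  intro S hS
  simp only [W2A4R4M52, List.mem_cons, List.not_mem_nil, or_false] at hS
  rcases hS with rfl | rfl
  · exact isRaise2_of_raise_raise T52R4 (by decide) (by decide)
  · exact isRaise2_of_raise_raise T52R4 (by decide) (by decide)

/-- `LawA4` class clauses for `b = bLin (8·38) (6·38) 38` modulo `37` (frame `56`, `θ = 37/38`), by `decide`. -/
theorem ray4ClassesA4_38_37 : LawA4Classes (bLin (8 * 38) (6 * 38) 38) 37 56 T56R4 :=
  lawA4Classes_of_cert _ _ _ _ W2A4R4M56 (by decide +kernel) W2A4R4M56_ok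

/-- `v_37(Cas₇(b(38))) ≥ -105` on ray #4, UNCONDITIONALLY (THEOREM A⁗ by name). -/
theorem ray4_casoratianA4_38_37 (hne : casoratian (bLin (8 * 38) (6 * 38) 38) 7 ≠ 0) :
    (-105 : ℤ) ≤ padicValRat 37 (casoratian (bLin (8 * 38) (6 * 38) 38) 7) := by
  have key := lawA4_ray4 38 37 56 T56R4 (by norm_num) (by norm_num) (by norm_num) (by norm_num) (by norm_num) (by norm_num)
    (by decide) T56R4_reverse ray4ClassesA4_38_37 hne
  have e : (7 : ℤ) - 2 * ((56 : ℕ) : ℤ) = -105 := by norm_num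
  rw [e] at key; exact key

/-- `LawA4` class clauses for `b = bLin (8·75) (6·75) 75` modulo `73` (frame `56`, `θ = 73/75`), by `decide`. -/
theorem ray4ClassesA4_75_73 : LawA4Classes (bLin (8 * 75) (6 * 75) 75) 73 56 T56R4 :=
  lawA4Classes_of_cert _ _ _ _ W2A4R4M56 (by decide +kernel) W2A4R4M56_ok

/-- `v_73(Cas₇(b(75))) ≥ -105` on ray #4, UNCONDITIONALLY (THEOREM A⁗ by name). -/
theorem ray4_casoratianA4_75_73 (hne : casoratian (bLin (8 * 75) (6 * 75) 75) 7 ≠ 0) :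
    (-105 : ℤ) ≤ padicValRat 73 (casoratian (bLin (8 * 75) (6 * 75) 75) 7) := by
  have key := lawA4_ray4 75 73 56 T56R4 (by norm_num) (by norm_num) (by norm_num) (by norm_num) (by norm_num) (by norm_num)
    (by decide) T56R4_reverse ray4ClassesA4_75_73 hne
  have e : (7 : ℤ) - 2 * ((56 : ℕ) : ℤ) = -105 := by norm_num
  rw [e] at key; exact key

/-- `LawA4` class clauses for `b = bLin (8·35) (6·35) 35` modulo `37` (frame `52`, `θ = 37/35`), by `decide`. -/
theorem ray4ClassesA4_35_37 : LawA4Classes (bLin (8 * 35) (6 * 35) 35) 37 52 T52R4 :=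
  lawA4Classes_of_cert _ _ _ _ W2A4R4M52 (by decide +kernel) W2A4R4M52_ok

/-- `v_37(Cas₇(b(35))) ≥ -97` on ray #4, UNCONDITIONALLY (THEOREM A⁗ by name). -/
theorem ray4_casoratianA4_35_37 (hne : casoratian (bLin (8 * 35) (6 * 35) 35) 7 ≠ 0) :
    (-97 : ℤ) ≤ padicValRat 37 (casoratian (bLin (8 * 35) (6 * 35) 35) 7) := by
  have key := lawA4_ray4 35 37 52 T52R4 (by norm_num) (by norm_num) (by norm_num) (by norm_num) (by norm_num) (by norm_num)
    (by decide) T52R4_reverse ray4ClassesA4_35_37 hne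
  have e : (7 : ℤ) - 2 * ((52 : ℕ) : ℤ) = -97 := by norm_num
  rw [e] at key; exact key

/-- `LawA4` class clauses for `b = bLin (8·70) (6·70) 70` modulo `73` (frame `52`, `θ = 73/70`), by `decide`. -/
theorem ray4ClassesA4_70_73 : LawA4Classes (bLin (8 * 70) (6 * 70) 70) 73 52 T52R4 :=
  lawA4Classes_of_cert _ _ _ _ W2A4R4M52 (by decide +kernel) W2A4R4M52_ok

/-- `v_73(Cas₇(b(70))) ≥ -97` on ray #4, UNCONDITIONALLY (THEOREM A⁗ by name). -/
theorem ray4_casoratianA4_70_73 (hne : casoratian (bLin (8 * 70) (6 * 70) 70) 7 ≠ 0) :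
    (-97 : ℤ) ≤ padicValRat 73 (casoratian (bLin (8 * 70) (6 * 70) 70) 7) := by
  have key := lawA4_ray4 70 73 52 T52R4 (by norm_num) (by norm_num) (by norm_num) (by norm_num) (by norm_num) (by norm_num)
    (by decide) T52R4_reverse ray4ClassesA4_70_73 hne
  have e : (7 : ℤ) - 2 * ((52 : ℕ) : ℤ) = -97 := by norm_num
  rw [e] at key; exact key

/-! ## §4 Transfer: the L5 frame from the unshifted clauses; L5 nodes from the `LawA4` nodes + shape clauses -/

/-- **The ray-4 L5 frame from `b` alone** (typer g13's transport `lawA4Classes_shift` / `shapeClause_shift`, general in `b`):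
`LawA4Classes` and `ShapeClause` for `b = bLin (8n) (6n) n` give all four clauses of `Ray4FrameL5 n p M T`. -/
theorem ray4FrameL5_of_unshifted {n p M : ℕ} {T : List ℤ} (hn : 1 ≤ n) (hprime : p.Prime) (hpn : p ≤ 34 * n) (hM : 6 ≤ M)
    (hC : LawA4Classes (bLin (8 * n) (6 * n) n) p M T) (hS : ShapeClause (bLin (8 * n) (6 * n) n) p M T) :
    Ray4FrameL5 n p M T := by
  haveI : Fact p.Prime := ⟨hprime⟩
  have hb : InPolytope (bLin (8 * n) (6 * n) n) := inPolytope_bLin (by omega)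
  have hb' : InPolytope (shift (bLin (8 * n) (6 * n) n) 7) := inPolytope_shift_bLin hn (by omega)
  have hpb : (p : ℤ) ≤ bLin (8 * n) (6 * n) n 0 := by rw [bLin_zero]; push_cast; omega
  exact ⟨hC, lawA4Classes_shift _ hb hb' (by norm_num) le_rfl hpb hM hC, hS,
    shapeClause_shift _ hb hb' (by norm_num) le_rfl hpb hM hC hS⟩

/-- **SHAPE CLAUSE (T4), frame 52, on the L5 window `θ ∈ (1, 25/24]`** (the one clause per class the long-class machine
adds to `Ray4ClassesA4M52`): conjecture node, checked with the frame at every window prime `n ≤ 130` (58/58, `r4shapes.py`). -/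
@[conjecture] def Ray4ShapeM52 : Prop :=
  ∀ n p : ℕ, 2 ≤ n → p.Prime → n < p → 24 * p ≤ 25 * n → 34 * n + 2 < p ^ 2 →
    ShapeClause (bLin (8 * n) (6 * n) n) p 52 T52R4

/-- **SHAPE CLAUSE (T4), frame 56, on the L5 window `θ ∈ (17/18, 25/26]`**: conjecture node (27/27, `n ≤ 130`). -/
@[conjecture] def Ray4ShapeM56 : Prop :=
  ∀ n p : ℕ, 2 ≤ n → p.Prime → 17 * n < 18 * p → 26 * p ≤ 25 * n → 34 * n + 2 < p ^ 2 →
    ShapeClause (bLin (8 * n) (6 * n) n) p 56 T56R4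

/-- **Reduction (PROVED)**: the `LawA4` node (frame 52, on the wider window `(1, 18/17]`) and the shape node give the L5
node `Ray4ShapesL5M52` of `Ray4FrameL5.lean` — hence (`ray4WindowL5M52_of`) the window bound `−96`. -/
theorem ray4ShapesL5M52_of_classes (hA : Ray4ClassesA4M52) (hS : Ray4ShapeM52) : Ray4ShapesL5M52 := by
  intro n p hn hp h1 h2 h3
  exact ray4FrameL5_of_unshifted (by omega) hp (by omega) (by norm_num) (hA n p hn hp h1 (by omega) h3) (hS n p hn hp h1 h2 h3)

/-- **Reduction (PROVED)**: frame 56 — `Ray4ClassesA4M56` (on `(17/18, 1]`) and `Ray4ShapeM56` give `Ray4ShapesL5M56`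
(hence the window bound `−104` by `ray4WindowL5M56_of`). -/
theorem ray4ShapesL5M56_of_classes (hA : Ray4ClassesA4M56) (hS : Ray4ShapeM56) : Ray4ShapesL5M56 := by
  intro n p hn hp h1 h2 h3
  exact ray4FrameL5_of_unshifted (by omega) hp (by omega) (by norm_num) (hA n p hn hp h1 (by omega) h3) (hS n p hn hp h1 h2 h3)

/-- The L5 window bound `−96` on `θ ∈ (1, 25/24]` from the two class-structure nodes (everything else PROVED). -/
theorem ray4WindowL5M52_of_classes (hA : Ray4ClassesA4M52) (hS : Ray4ShapeM52) : Ray4WindowL5M52 :=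
  ray4WindowL5M52_of (ray4ShapesL5M52_of_classes hA hS)

/-- The L5 window bound `−104` on `θ ∈ (17/18, 25/26]` from the two class-structure nodes. -/
theorem ray4WindowL5M56_of_classes (hA : Ray4ClassesA4M56) (hS : Ray4ShapeM56) : Ray4WindowL5M56 :=
  ray4WindowL5M56_of (ray4ShapesL5M56_of_classes hA hS)

end Summit.KontsevichZagierPeriods.Zeta5Search.Ray4Windows
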